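import Summits.CriticalPhenomena.CardyFormulaZ2.Theorems.CardyBoundaryCoulombGasRectilinearCardyLocalToGlobal

/-!
# Stub `stub_localToGlobal` of line `excursion-kernel-covariance`, piece (P1): abstract gluing,
# part 2 of 2 — the filter bookkeeping
# (crux `RectilinearCardy`, stmt-CriticalPhenomena-5660, route `CardyBoundaryCoulombGas`)

Pure real analysis. From the static estimate `localToGlobal_static` of part 1: two eventually
non-increasing families `Q δ`, `ν δ` on `[m₁, m₃]` with `Q δ m₁ → 1`, `ν δ m₁ = 1`, `Q δ m₃ → 0`,
`ν δ m₃ → 0` as `δ → 0⁺`, tight on `γ`-short windows (`γ` a continuous curve), and obeying the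
double-ratio law `ΔQ(I) Δν(J) ≈ ΔQ(J) Δν(I)` eventually for every pair of FIXED windows inside
admissible ranges — every range `[σ, σ'] ⊆ (m₁, m₃)` avoiding a finite exceptional set `T` being
admissible — satisfy `Q δ s - ν δ s → 0` for every `s ∈ [m₁, m₃]`.

Proof. Cut `[m₁, m₃]` at `{m₁, m₃} ∪ (T ∩ (m₁, m₃))` (increasing enumeration
`Finset.orderEmbOfFin`), choose the relative error `ε` against the number of cells, the tightness
radius for `ε`, and a margin `w` below a third of the minimal gap and so small (uniform
continuity of `γ` on the compact parameter interval) that parameter windows of length `≤ 2w` are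
`γ`-short; the good ranges are admissible, the law is invoked on the finitely many fixed window
pairs BEFORE passing to `∀ᶠ δ` (`Filter.eventually_all_finset`), and `localToGlobal_static`
concludes.
-/

noncomputable section

open Set Filter Topology

namespace Summit.CriticalPhenomena.CardyFormulaZ2.Cruxes.RectilinearCardy.ExcursionKernelCovariance

/-- **(P1) Abstract local-to-global gluing** for the line `excursion-kernel-covariance` (the
`ε`-bookkeeping of stub `stub_localToGlobal`, over no vocabulary but real numbers and filters):
two eventually non-increasing families `Q δ`, `ν δ` on `[m₁, m₃]` with matching endpoint limits
(`Q δ m₁ → 1`, `ν δ m₁ = 1`, `Q δ m₃ → 0`, `ν δ m₃ → 0`), tight on `γ`-short windows, and obeying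
the double-ratio law on pairs of fixed windows inside admissible ranges — every range in
`(m₁, m₃)` off a finite exceptional set `T` being admissible — satisfy `Q δ s - ν δ s → 0` as
`δ → 0⁺` for every `s ∈ [m₁, m₃]`. [folklore] -/
theorem localToGlobal_abstract {Q ν : ℝ → ℝ → ℝ} {m₁ m₃ : ℝ} {γ : ℝ → ℂ}
    {Good : ℝ → Prop} {Adm : ℝ → ℝ → Prop} (h13 : m₁ < m₃) (hγ : Continuous γ)
    (T : Finset ℝ) (hT : ∀ s ∈ Icc m₁ m₃, s ∉ T → Good s)
    (hAdm : ∀ σ σ' : ℝ, m₁ < σ → σ ≤ σ' → σ' < m₃ → (∀ s ∈ Icc σ σ', Good s) → Adm σ σ')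
    (hQanti : ∀ᶠ δ in 𝓝[>] (0 : ℝ), AntitoneOn (Q δ) (Icc m₁ m₃))
    (hνanti : ∀ᶠ δ in 𝓝[>] (0 : ℝ), AntitoneOn (ν δ) (Icc m₁ m₃))
    (hQle : ∀ᶠ δ in 𝓝[>] (0 : ℝ), Q δ m₁ ≤ 1)
    (hν1 : ∀ᶠ δ in 𝓝[>] (0 : ℝ), ν δ m₁ = 1)
    (hQ1 : Tendsto (fun δ => Q δ m₁) (𝓝[>] 0) (𝓝 1))
    (hQ3 : Tendsto (fun δ => Q δ m₃) (𝓝[>] 0) (𝓝 0))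
    (hν3 : Tendsto (fun δ => ν δ m₃) (𝓝[>] 0) (𝓝 0))
    (hQtight : ∀ ε : ℝ, 0 < ε → ∃ ρ : ℝ, 0 < ρ ∧ ∀ᶠ δ in 𝓝[>] (0 : ℝ), ∀ s s' : ℝ,
        m₁ ≤ s → s ≤ s' → s' ≤ m₃ → Metric.diam (γ '' Icc s s') ≤ ρ → Q δ s - Q δ s' ≤ ε)
    (hνtight : ∀ ε : ℝ, 0 < ε → ∃ ρ : ℝ, 0 < ρ ∧ ∀ᶠ δ in 𝓝[>] (0 : ℝ), ∀ s s' : ℝ,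
        m₁ ≤ s → s ≤ s' → s' ≤ m₃ → Metric.diam (γ '' Icc s s') ≤ ρ → ν δ s - ν δ s' ≤ ε)
    (hlaw : ∀ σ σ' τ τ' : ℝ, Adm σ σ' → Adm τ τ' → ∀ ε : ℝ, 0 < ε → ∀ s s' t t' : ℝ,
        σ ≤ s → s ≤ s' → s' ≤ σ' → τ ≤ t → t ≤ t' → t' ≤ τ' → ∀ᶠ δ in 𝓝[>] (0 : ℝ),
          |(Q δ s - Q δ s') * (ν δ t - ν δ t') - (Q δ t - Q δ t') * (ν δ s - ν δ s')|
            ≤ ε * ((Q δ s - Q δ s') * (ν δ t - ν δ t') + (Q δ t - Q δ t') * (ν δ s - ν δ s'))) :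
    ∀ s ∈ Icc m₁ m₃, Tendsto (fun δ => Q δ s - ν δ s) (𝓝[>] 0) (𝓝 0) := by
  intro x hx
  rw [Metric.tendsto_nhds]
  intro η hη
  classical
  /- 1. The cut points: `m₁`, `m₃` and the exceptional parameters strictly in between. -/
  obtain ⟨P, hP⟩ : ∃ P : Finset ℝ, P = insert m₁ (insert m₃ (T.filter fun t => m₁ < t ∧ t < m₃)) :=
    ⟨_, rfl⟩
  have hm₁P : m₁ ∈ P := by rw [hP]; exact Finset.mem_insert_self _ _
  have hm₃P : m₃ ∈ P := by rw [hP]; exact Finset.mem_insert_of_mem (Finset.mem_insert_self _ _)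
  have hPI : ∀ t ∈ P, m₁ ≤ t ∧ t ≤ m₃ := by
    intro t ht
    rw [hP, Finset.mem_insert, Finset.mem_insert, Finset.mem_filter] at ht
    rcases ht with rfl | rfl | ⟨-, h1, h3⟩
    · exact ⟨le_rfl, h13.le⟩
    · exact ⟨h13.le, le_rfl⟩
    · exact ⟨h1.le, h3.le⟩
  have hTP : ∀ t ∈ T, m₁ ≤ t → t ≤ m₃ → t ∈ P := by
    intro t ht h1 h3
    rw [hP, Finset.mem_insert, Finset.mem_insert, Finset.mem_filter]
    rcases h1.eq_or_lt with h1 | h1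
    · exact Or.inl h1.symm
    rcases h3.eq_or_lt with h3 | h3
    · exact Or.inr (Or.inl h3)
    exact Or.inr (Or.inr ⟨ht, h1, h3⟩)
  obtain ⟨M, hMc⟩ : ∃ M : ℕ, P.card = M + 1 :=
    ⟨P.card - 1, (Nat.succ_pred_eq_of_pos (Finset.card_pos.2 ⟨m₁, hm₁P⟩)).symm⟩
  have hM : 0 < M := by
    have : 1 < P.card := Finset.one_lt_card.2 ⟨m₁, hm₁P, m₃, hm₃P, h13.ne⟩
    omega
  -- the increasing enumeration of `P`, extended by `m₃`
  obtain ⟨p, hp⟩ : ∃ p : ℕ → ℝ, ∀ i,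
      p i = if hi : i < M + 1 then P.orderEmbOfFin hMc ⟨i, hi⟩ else m₃ :=
    ⟨fun i => if hi : i < M + 1 then P.orderEmbOfFin hMc ⟨i, hi⟩ else m₃, fun _ => rfl⟩
  have hpv : ∀ (i : ℕ) (hi : i < M + 1), p i = P.orderEmbOfFin hMc ⟨i, hi⟩ := fun i hi => by
    rw [hp, dif_pos hi]
  have heP : ∀ t ∈ P, ∃ i : Fin (M + 1), P.orderEmbOfFin hMc i = t := fun t ht => by
    have : t ∈ Set.range (P.orderEmbOfFin hMc) := by
      rw [Finset.range_orderEmbOfFin]; exact Finset.mem_coe.2 ht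
    exact Set.mem_range.1 this
  have hePI : ∀ i : Fin (M + 1), m₁ ≤ P.orderEmbOfFin hMc i ∧ P.orderEmbOfFin hMc i ≤ m₃ :=
    fun i => hPI _ (Finset.orderEmbOfFin_mem P hMc i)
  have hp0 : p 0 = m₁ := by
    rw [hpv 0 (Nat.succ_pos M)]
    obtain ⟨i, hi⟩ := heP m₁ hm₁P
    refine le_antisymm ?_ (hePI _).1
    calc P.orderEmbOfFin hMc ⟨0, Nat.succ_pos M⟩ ≤ P.orderEmbOfFin hMc i :=
          (P.orderEmbOfFin hMc).monotone (Fin.le_iff_val_le_val.2 (Nat.zero_le _))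
      _ = m₁ := hi
  have hpM : p M = m₃ := by
    rw [hpv M (Nat.lt_succ_self M)]
    obtain ⟨i, hi⟩ := heP m₃ hm₃P
    refine le_antisymm (hePI _).2 ?_
    calc m₃ = P.orderEmbOfFin hMc i := hi.symm
      _ ≤ P.orderEmbOfFin hMc ⟨M, Nat.lt_succ_self M⟩ :=
          (P.orderEmbOfFin hMc).monotone (Fin.le_iff_val_le_val.2 (Nat.le_of_lt_succ i.2))
  have hmono : ∀ i j : ℕ, i ≤ j → j ≤ M → p i ≤ p j := fun i j hij hjM => by
    rw [hpv i (by omega), hpv j (by omega)]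
    exact (P.orderEmbOfFin hMc).monotone (Fin.mk_le_mk.2 hij)
  have hpmono : ∀ i < M, p i < p (i + 1) := fun i hi => by
    rw [hpv i (by omega), hpv (i + 1) (by omega)]
    exact (P.orderEmbOfFin hMc).strictMono (Fin.mk_lt_mk.2 (Nat.lt_succ_self i))
  have hpT : ∀ t ∈ T, m₁ ≤ t → t ≤ m₃ → ∃ j, j ≤ M ∧ p j = t := fun t ht h1 h3 => by
    obtain ⟨i, hi⟩ := heP t (hTP t ht h1 h3)
    exact ⟨i, Nat.le_of_lt_succ i.2, by rw [hpv i i.2]; exact hi⟩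
  /- 2. The scales: minimal gap `g₀`, relative error `ε`, tightness radius, margin `w`. -/
  obtain ⟨i₀, hi₀, hgmin⟩ :=
    (Finset.range M).exists_min_image (fun i => p (i + 1) - p i) ⟨0, Finset.mem_range.2 hM⟩
  have hg₀ : 0 < p (i₀ + 1) - p i₀ := sub_pos.2 (hpmono i₀ (Finset.mem_range.1 hi₀))
  have hK : (0 : ℝ) < 2 + (M + 1) * (4 * M + 14) := by positivity
  obtain ⟨ε, hε0, hε1, hεK⟩ : ∃ ε : ℝ, 0 < ε ∧ ε ≤ 1 ∧ (2 + (M + 1) * (4 * M + 14)) * ε < η := by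
    refine ⟨min 1 (η / (2 * (2 + (M + 1) * (4 * M + 14)))), lt_min one_pos (by positivity),
      min_le_left _ _, ?_⟩
    calc (2 + (M + 1) * (4 * M + 14)) * min 1 (η / (2 * (2 + (M + 1) * (4 * M + 14))))
        ≤ (2 + (M + 1) * (4 * M + 14)) * (η / (2 * (2 + (M + 1) * (4 * M + 14)))) :=
          mul_le_mul_of_nonneg_left (min_le_right _ _) hK.le
      _ = η / 2 := by field_simp
      _ < η := by linarith
  obtain ⟨ρ₁, hρ₁, hQt⟩ := hQtight ε hε0
  obtain ⟨ρ₂, hρ₂, hνt⟩ := hνtight ε hε0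
  obtain ⟨θ, hθ, hγu⟩ := Metric.uniformContinuousOn_iff.1
    ((isCompact_Icc (a := m₁) (b := m₃)).uniformContinuousOn_of_continuous hγ.continuousOn)
    (min ρ₁ ρ₂) (lt_min hρ₁ hρ₂)
  obtain ⟨w, hw0, hwg, hwθ⟩ : ∃ w : ℝ, 0 < w ∧ 2 * w < p (i₀ + 1) - p i₀ ∧ 2 * w < θ :=
    ⟨min ((p (i₀ + 1) - p i₀) / 3) (θ / 3), lt_min (by positivity) (by positivity),
      by linarith [min_le_left ((p (i₀ + 1) - p i₀) / 3) (θ / 3)],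
      by linarith [min_le_right ((p (i₀ + 1) - p i₀) / 3) (θ / 3)]⟩
  have hgap : ∀ i < M, p i + 2 * w < p (i + 1) := fun i hi => by
    have := hgmin i (Finset.mem_range.2 hi)
    linarith
  -- windows of parameter length `≤ 2w` are `γ`-short
  have hdiam : ∀ s s', m₁ ≤ s → s ≤ s' → s' ≤ m₃ → s' ≤ s + 2 * w →
      Metric.diam (γ '' Icc s s') ≤ min ρ₁ ρ₂ := by
    intro s s' h1 _ h3 h4
    refine Metric.diam_le_of_forall_dist_le (le_min hρ₁.le hρ₂.le) ?_
    rintro _ ⟨u, hu, rfl⟩ _ ⟨v, hv, rfl⟩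
    refine (hγu u ⟨h1.trans hu.1, hu.2.trans h3⟩ v ⟨h1.trans hv.1, hv.2.trans h3⟩ ?_).le
    calc dist u v ≤ s' - s := Real.dist_le_of_mem_Icc hu hv
      _ < θ := by linarith
  have hQt' : ∀ᶠ δ in 𝓝[>] (0 : ℝ), ∀ s s', m₁ ≤ s → s ≤ s' → s' ≤ m₃ → s' ≤ s + 2 * w →
      Q δ s - Q δ s' ≤ ε :=
    hQt.mono fun δ hδ s s' h1 h2 h3 h4 =>
      hδ s s' h1 h2 h3 ((hdiam s s' h1 h2 h3 h4).trans (min_le_left _ _))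
  have hνt' : ∀ᶠ δ in 𝓝[>] (0 : ℝ), ∀ s s', m₁ ≤ s → s ≤ s' → s' ≤ m₃ → s' ≤ s + 2 * w →
      ν δ s - ν δ s' ≤ ε :=
    hνt.mono fun δ hδ s s' h1 h2 h3 h4 =>
      hδ s s' h1 h2 h3 ((hdiam s s' h1 h2 h3 h4).trans (min_le_right _ _))
  /- 3. The good ranges `[p i + w, p (i+1) - w]` are admissible. -/
  have hAdmG : ∀ i < M, Adm (p i + w) (p (i + 1) - w) := by
    intro i hi
    have h1 : m₁ ≤ p i := hp0 ▸ hmono 0 i (Nat.zero_le _) hi.le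
    have h3 : p (i + 1) ≤ m₃ := hpM ▸ hmono (i + 1) M hi le_rfl
    have hgi := hgap i hi
    refine hAdm _ _ (by linarith) (by linarith) (by linarith) fun s hs =>
      hT s ⟨by linarith [hs.1], by linarith [hs.2]⟩ fun hsT => ?_
    obtain ⟨j, hjM, hj⟩ := hpT s hsT (by linarith [hs.1]) (by linarith [hs.2])
    rcases le_or_gt j i with hji | hij
    · have := hmono j i hji hi.le
      linarith [hs.1]
    · have := hmono (i + 1) j hij hjM
      linarith [hs.2]
  /- 4. The law on the finitely many fixed window pairs, eventually and simultaneously. -/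
  have hlawG : ∀ᶠ δ in 𝓝[>] (0 : ℝ), ∀ i ∈ Finset.range M, ∀ j ∈ Finset.range M,
      |(Q δ (p i + w) - Q δ (p (i + 1) - w)) * (ν δ (p j + w) - ν δ (p (j + 1) - w)) -
          (Q δ (p j + w) - Q δ (p (j + 1) - w)) * (ν δ (p i + w) - ν δ (p (i + 1) - w))| ≤
        ε * ((Q δ (p i + w) - Q δ (p (i + 1) - w)) * (ν δ (p j + w) - ν δ (p (j + 1) - w)) +
          (Q δ (p j + w) - Q δ (p (j + 1) - w)) * (ν δ (p i + w) - ν δ (p (i + 1) - w))) := by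
    refine (Filter.eventually_all_finset _).2 fun i hi =>
      (Filter.eventually_all_finset _).2 fun j hj => ?_
    have hi' := Finset.mem_range.1 hi
    have hj' := Finset.mem_range.1 hj
    exact hlaw _ _ _ _ (hAdmG i hi') (hAdmG j hj') ε hε0 _ _ _ _ le_rfl
      (by linarith [hgap i hi']) le_rfl le_rfl (by linarith [hgap j hj']) le_rfl
  have hlawX : ∀ᶠ δ in 𝓝[>] (0 : ℝ), ∀ i ∈ Finset.range M, ∀ j ∈ Finset.range M,
      p i + w ≤ x → x ≤ p (i + 1) - w →
      |(Q δ x - Q δ (p (i + 1) - w)) * (ν δ (p j + w) - ν δ (p (j + 1) - w)) -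
          (Q δ (p j + w) - Q δ (p (j + 1) - w)) * (ν δ x - ν δ (p (i + 1) - w))| ≤
        ε * ((Q δ x - Q δ (p (i + 1) - w)) * (ν δ (p j + w) - ν δ (p (j + 1) - w)) +
          (Q δ (p j + w) - Q δ (p (j + 1) - w)) * (ν δ x - ν δ (p (i + 1) - w))) := by
    refine (Filter.eventually_all_finset _).2 fun i hi =>
      (Filter.eventually_all_finset _).2 fun j hj => ?_
    have hi' := Finset.mem_range.1 hi
    have hj' := Finset.mem_range.1 hj
    by_cases hxi : p i + w ≤ x ∧ x ≤ p (i + 1) - w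
    · exact (hlaw _ _ _ _ (hAdmG i hi') (hAdmG j hj') ε hε0 x (p (i + 1) - w) (p j + w)
        (p (j + 1) - w) hxi.1 hxi.2 le_rfl le_rfl (by linarith [hgap j hj']) le_rfl).mono
          fun δ hδ _ _ => hδ
    · exact Filter.Eventually.of_forall fun δ h1 h2 => (hxi ⟨h1, h2⟩).elim
  have hQ1' : ∀ᶠ δ in 𝓝[>] (0 : ℝ), 1 - ε ≤ Q δ m₁ :=
    (Metric.tendsto_nhds.1 hQ1 ε hε0).mono fun δ hδ => by
      rw [Real.dist_eq] at hδ
      linarith [(abs_lt.1 hδ).1]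
  have hQ3' : ∀ᶠ δ in 𝓝[>] (0 : ℝ), |Q δ m₃| ≤ ε :=
    (Metric.tendsto_nhds.1 hQ3 ε hε0).mono fun δ hδ => by
      rw [Real.dist_eq, sub_zero] at hδ
      exact hδ.le
  have hν3' : ∀ᶠ δ in 𝓝[>] (0 : ℝ), |ν δ m₃| ≤ ε :=
    (Metric.tendsto_nhds.1 hν3 ε hε0).mono fun δ hδ => by
      rw [Real.dist_eq, sub_zero] at hδ
      exact hδ.le
  /- 5. Glue. -/
  filter_upwards [hQanti, hνanti, hQle, hν1, hQ1', hQ3', hν3', hQt', hνt', hlawG, hlawX]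
    with δ h1 h2 h3 h4 h5 h6 h7 h8 h9 h10 h11
  rw [Real.dist_eq, sub_zero]
  refine lt_of_le_of_lt (localToGlobal_static hM hp0 hpM hgap hw0 hε0 hε1 h1 h2 h3 h5 h6 h4 h7 h8 h9
    (fun i hi j hj => h10 i (Finset.mem_range.2 hi) j (Finset.mem_range.2 hj))
    (fun i hi hx1 hx2 j hj => h11 i (Finset.mem_range.2 hi) j (Finset.mem_range.2 hj) hx1 hx2) hx)
    hεK

end Summit.CriticalPhenomena.CardyFormulaZ2.Cruxes.RectilinearCardy.ExcursionKernelCovariance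

end
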